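import Literature.NumberTheory.LocalFields.WildQuadraticDatumNormOneQuotient   -- ★ B0 p855667 (LH4-p09): `two_le_of_v_two_lt_one` (`v 2 < 1 ⇒ 2 ≤ d`); brings ★ p854561 `WildQuadraticDatumTrace` (`v_add_map_le_exp` = `Tr 𝔭_E^j ⊆ 𝔭_F^{⌊(j+d)∕2⌋}`, `v_varpi_pow`)
import Literature.NumberTheory.Automorphic.UnitaryThreeFourFrameDefs      -- ★ `IsRamifiedQuadraticDatum` (the four-frame sheet's datum predicate; light imports)
import HarnessLib

/-!
# The WILD TRACE BOUND of a ramified quadratic datum: `|a + σa| ≤ |ϖ|^{d−1}·|a|` for every `a`, hence `|a + σa| ≤ |ϖ|·|a|` once `d ≥ 2` — i.e. under the dyadic fence `|2| < 1`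
# (Serre, *Local Fields* III §3 Prop. 7 ∕ III §6 Prop. 13: `Tr 𝔭_E^j = 𝔭_F^{⌊(j+d)∕2⌋}`)

Topic `NumberTheory/LocalFields`; namespace `Literature.NumberTheory.LocalFields.WildQuadraticDatum` (the one-field datum of ★ `WildQuadraticDatumTrace`).  THEOREMS ONLY
(no definition, no instance, no notation, no named fact, no `sorry`).  Cell `pub/hodgecm-mathlib` (D-0151), crux H413 = `stmt-HodgeConjecture-24833`; helper lane
`--supports stmt-HodgeConjecture-24833`; MS road A, Stage B: the OWED MICRO-BRICK «hTr DISCHARGE» (LH-ref2 (g9) BOX #16 scope note, 2026-09-03T23:54:48Z): the binder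
`hTr : ∀ a, |a + σa| ≤ |ϖ|·|a|` of ★ B5 (i) `F0P3cDyRamDiagonalGluedTubeCriterion` (:180∕:343) and ★ B7 (i) `F0P3cDyRamDiagonalCoreHangingCriterion` — consumed by B5 (iii)(iv),
B6, B7 and the B10 assembly — discharged from the datum, WITHOUT completeness or finiteness.

THE MATHEMATICS.  ★ `v_add_map_le_exp` is the trace-image inclusion `Tr 𝔭_E^j ⊆ 𝔭_F^{⌊(j+d)∕2⌋}` in the division-free form `v x ≤ exp(−j)`, `2m ≤ j + d ⇒ v(x + σx) ≤ exp(−2m)`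
(coordinates `x = α + βϖ` with `σ`-fixed `α, β`: `Tr x = 2α + β·Tr ϖ`, `|2α| ≤ |ϖ|^t|α|`, `|β·Tr ϖ| ≤ |ϖ|^d|β|`, parities).  Taking `j := −log v a` and `m := ⌊(j + d)∕2⌋` gives
`2m ≥ j + d − 1`, so **`v(a + σa) ≤ exp(−(j + d − 1)) = (vϖ)^{d−1}·v a`** (§1 `v_add_map_le_pow_pred_mul`; `a = 0` trivially).  For `d ≥ 2`, `(vϖ)^{d−1} ≤ vϖ` (§1
`v_add_map_le_varpi_mul`).  Under the dyadic fence `v 2 < 1` one has `2 ≤ d` (★ B0 `two_le_of_v_two_lt_one`), so the bound holds for EVERY ramified quadratic datum under the fence (§2 `trace_bound_of_isRamifiedQuadraticDatum`, the sheet's predicate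
★ `IsRamifiedQuadraticDatum σ ϖ d t` destructured once).  No use of `|σ·| = |·|` beyond what ★ already proved; no `d`-parity case split.

* §1 `v_add_map_le_pow_pred_mul`, `v_add_map_le_varpi_mul`, **`v_add_map_le_varpi_mul_of_v_two_lt_one`** (conjunct currency `hσ hvσ hfix hϖ hd ht`).
* §2 **`trace_bound_of_isRamifiedQuadraticDatum`** (`(hD : IsRamifiedQuadraticDatum σ ϖ d t) (h2 : v 2 < 1) : ∀ a, v (a + σ a) ≤ v ϖ * v a`) and the sharper
  `trace_bound_pow_of_isRamifiedQuadraticDatum` (`≤ (vϖ)^{d−1}·v a`, no fence).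

HONEST LABEL: HC_CM is proved only modulo the 7 printed citations (2 remaining named inputs: hLiu418 = stmt-HodgeConjecture-24832, h413 = stmt-HodgeConjecture-24833) until rung 0
closes; count-neutral (elementary valuation algebra; nothing printed is asserted).

## References
* [Serre1979] J.-P. Serre, *Local Fields*, GTM 67 (1979), Ch. III §3 Prop. 7 (`Tr 𝔟 ⊆ 𝔞 ⟺ 𝔟 ⊆ 𝔞𝒟⁻¹`), Ch. III §6 Prop. 13 and Remark (the different of a totally ramified extension).
-/

set_option autoImplicit false

open WithZero
open scoped Valued

namespace Literature.NumberTheory.LocalFields.WildQuadraticDatum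

open Literature.NumberTheory.Automorphic

/-! ## §1 The bound in conjunct currency -/

section Conjuncts

variable {K : Type*} [Field K] [Valued K ℤᵐ⁰] {σ : K →+* K} {ϖ : K} {d t : ℕ}

/-- **THE DIFFERENT BOUND ON TRACES**: `v(a + σa) ≤ (vϖ)^{d−1}·v a` for every `a` (`d ≥ 1`) — `Tr 𝔭_E^j ⊆ 𝔭_F^{⌊(j+d)∕2⌋} ⊆ 𝔭_E^{j+d−1}` at `j = −log v a`
(★ `v_add_map_le_exp`). [cite: Serre1979, Ch. III §3 Prop. 7] -/
theorem v_add_map_le_pow_pred_mul (hσ : ∀ x, σ (σ x) = x)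
    (hfix : ∀ x : K, σ x = x → x ≠ 0 → ∃ n : ℤ, Valued.v x = exp (2 * n))
    (hϖ : Valued.v ϖ = exp (-1 : ℤ)) (hd : Valued.v (ϖ - σ ϖ) = Valued.v ϖ ^ d) (ht : Valued.v (2 : K) = Valued.v ϖ ^ t)
    (h1d : 1 ≤ d) (a : K) : Valued.v (a + σ a) ≤ Valued.v ϖ ^ (d - 1) * Valued.v a := by
  rcases eq_or_ne a 0 with rfl | ha0
  · rw [map_zero, add_zero, map_zero, mul_zero]
  obtain ⟨e, he⟩ : ∃ e : ℤ, Valued.v a = exp e := ⟨_, (exp_log ((Valuation.ne_zero_iff _).2 ha0)).symm⟩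
  obtain ⟨m, hm1, hm2⟩ : ∃ m : ℤ, 2 * m ≤ -e + d ∧ -e + d ≤ 2 * m + 1 := ⟨(-e + d) / 2, by omega, by omega⟩
  have h := v_add_map_le_exp hσ hfix hϖ hd ht (x := a) (j := -e) (m := m) (by rw [neg_neg, he]) hm1
  refine h.trans ?_
  rw [he, v_varpi_pow hϖ, ← exp_add, exp_le_exp]
  omega

/-- **THE WILD TRACE BOUND**: `v(a + σa) ≤ vϖ·v a` for every `a` once `d ≥ 2` (= the binder `hTr` of ★ B5 (i) ∕ B7 (i)). [cite: Serre1979, Ch. III §3 Prop. 7] -/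
theorem v_add_map_le_varpi_mul (hσ : ∀ x, σ (σ x) = x)
    (hfix : ∀ x : K, σ x = x → x ≠ 0 → ∃ n : ℤ, Valued.v x = exp (2 * n))
    (hϖ : Valued.v ϖ = exp (-1 : ℤ)) (hd : Valued.v (ϖ - σ ϖ) = Valued.v ϖ ^ d) (ht : Valued.v (2 : K) = Valued.v ϖ ^ t)
    (h2d : 2 ≤ d) (a : K) : Valued.v (a + σ a) ≤ Valued.v ϖ * Valued.v a := by
  refine (v_add_map_le_pow_pred_mul hσ hfix hϖ hd ht (by omega) a).trans (mul_le_mul_left ?_ _)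
  rw [v_varpi_pow hϖ, hϖ, exp_le_exp]
  omega

/-- **THE WILD TRACE BOUND UNDER THE DYADIC FENCE** (conjunct currency): `v 2 < 1 ⇒ ∀ a, v(a + σa) ≤ vϖ·v a` (`2 ≤ d` by ★ B0 `two_le_of_v_two_lt_one`).
[cite: Serre1979, Ch. III §3 Prop. 7; Ch. III §6 Prop. 13] -/
theorem v_add_map_le_varpi_mul_of_v_two_lt_one (hσ : ∀ x, σ (σ x) = x) (hvσ : ∀ a, Valued.v (σ a) = Valued.v a)
    (hfix : ∀ x : K, σ x = x → x ≠ 0 → ∃ n : ℤ, Valued.v x = exp (2 * n))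
    (hϖ : Valued.v ϖ = exp (-1 : ℤ)) (hd : Valued.v (ϖ - σ ϖ) = Valued.v ϖ ^ d) (ht : Valued.v (2 : K) = Valued.v ϖ ^ t)
    (h2 : Valued.v (2 : K) < 1) : ∀ a : K, Valued.v (a + σ a) ≤ Valued.v ϖ * Valued.v a :=
  v_add_map_le_varpi_mul hσ hfix hϖ hd ht (two_le_of_v_two_lt_one hσ hvσ hfix hϖ hd ht h2)

end Conjuncts

/-! ## §2 The bound from the sheet's datum predicate `IsRamifiedQuadraticDatum` (universe-`0` field, as the predicate is typed) -/

section Datum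

variable {K : Type} [Field K] [Valued K ℤᵐ⁰] {σ : K →+* K} {ϖ : K} {d t : ℕ}

/-- **`hTr` DISCHARGED**: for every ramified quadratic datum `IsRamifiedQuadraticDatum σ ϖ d t` (★ `UnitaryThreeFourFrameDefs`) under the dyadic fence `v 2 < 1`:
`∀ a, v(a + σa) ≤ vϖ·v a` — the binder `hTr` of ★ B5 (i) `isDualisableLattice_latt_hnf_glued_iff` and ★ B7 (i) `isDualisableLattice_latt_hnf_coreHanging_iff`.
[cite: Serre1979, Ch. III §3 Prop. 7; Ch. III §6 Prop. 13] -/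
theorem trace_bound_of_isRamifiedQuadraticDatum (hD : UnitaryThreeFourFrame.IsRamifiedQuadraticDatum σ ϖ d t) (h2 : Valued.v (2 : K) < 1) :
    ∀ a : K, Valued.v (a + σ a) ≤ Valued.v ϖ * Valued.v a :=
  v_add_map_le_varpi_mul_of_v_two_lt_one hD.1 hD.2.1 hD.2.2.2.1 hD.2.2.1 hD.2.2.2.2.1 hD.2.2.2.2.2.2 h2

/-- **THE DIFFERENT BOUND from the datum predicate** (no fence): `∀ a, v(a + σa) ≤ (vϖ)^{d−1}·v a`. [cite: Serre1979, Ch. III §3 Prop. 7] -/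
theorem trace_bound_pow_of_isRamifiedQuadraticDatum (hD : UnitaryThreeFourFrame.IsRamifiedQuadraticDatum σ ϖ d t) :
    ∀ a : K, Valued.v (a + σ a) ≤ Valued.v ϖ ^ (d - 1) * Valued.v a :=
  v_add_map_le_pow_pred_mul hD.1 hD.2.2.2.1 hD.2.2.1 hD.2.2.2.2.1 hD.2.2.2.2.2.2 hD.2.2.2.2.2.1

end Datum

end Literature.NumberTheory.LocalFields.WildQuadraticDatum
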